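/-
Copyright (c) 2026 the pub-hodgecm-mathlib formalisation cell (harness21).  Prover seat hodgecm-mathlib-K2Liu-p13 (g2), Track B «K2-LIT»,
#184♮ = hLiu418 = `stmt-HodgeConjecture-24832`; Road I v3 organ U1-CT-ind STAGE 2 (Q2), file F4-2b (LEAD F0P6-plan (g14) 10:39:33Z «F4-2 → F4 → F5 → D-U1 stage 3 =»;
CENSUS-Q2-F4 `K2/K2Liu-p13/g2/CENSUS-Q2-F4-KlingenUnfold.K2Liu-p13-g2.md` (D1)(D2)).
-/
import Summits.HodgeConjecture.HodgeConjecture.Theorems.K2LiuSiegelEisensteinSubgroupPeriodCells   -- 📤 F4-2a: countability, measurability, `enorm_wt_smul_subgroup`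
import Summits.HodgeConjecture.HodgeConjecture.Theorems.K2LiuSiegelBruhatMiddleCellDelta           -- ★ B2b: `mk_mul_eq_mk_iff`
import HarnessLib

/-!
# Crux `HLiu418`, Road I v3, organ U1 stage 2 (Q2), file F4-2b: REGROUPING THE CLASSES OF `P_Δ(L⁺)\H(L⁺)` ALONG ONE `N(L⁺)`-ORBIT, FOR AN ARBITRARY
# SUBGROUP `N ≤ H(𝔸)` — `Σ'_{i ∈ Γ'\N(L⁺)} ∫ β(u) • f(γ₀ ν_i u h) dνN = ∫ β'(u) • f(γ₀ u h) dνN`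

Cell `hodgecm-mathlib`, crux item hLiu418 = `stmt-HodgeConjecture-24832`; squad K2 ∕ K2Liu; LEAD F0P6-plan (g14), co-dealer K2E5-plan (g7); prover K2Liu-p13 (g2).
THEOREMS ONLY (no `def`, no instance, no notation, no named-fact hypothesis, no `sorry`); lane `--supports stmt-HodgeConjecture-24832 --as helper` (count-neutral).

SETTING.  `Nsub ≤ H(𝔸)` any subgroup with caller-supplied Borel structure, `N(L⁺) := (ratH).subgroupOf Nsub = Nsub ∩ H(L⁺)` its (countable, 📤 F4-2a) lattice acting on
`↥Nsub` by left multiplication, `νN` a LEFT-INVARIANT measure on `↥Nsub`, `β` an `N(L⁺)`-covering weight, `f` a continuous Siegel section of `I_Δ(s, χ)`, `γ₀ ∈ H(L⁺)`,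
`h ∈ H(𝔸)`.  `N(L⁺)` acts on `P_Δ(L⁺)\H(L⁺)` on the right, `⟦γ⟧ ↦ ⟦γ ν⟧`; the orbit of `⟦γ₀⟧` is `{⟦γ₀ ν⟧}` with stabiliser `Stab(γ₀) = {ν : γ₀ ν γ₀⁻¹ ∈ P_Δ}`
(★ B2b `mk_mul_eq_mk_iff`), so it is parametrised by any SECTION `i ↦ ν_i ∈ N(L⁺)` of `Stab(γ₀)\N(L⁺)`, and along it `f(γ_{⟦γ₀ ν⟧} x) = f(γ₀ ν x)`.
This is ★ Φ2-3 `K2LiuSiegelEisensteinCoeffOrbitSum` (K2Liu-p06), there typed for `Nsub := unipDelta` with a character `ψ_S`; here for ANY `Nsub` and the trivial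
character (constant terms), so that the Q-constant term along the KLINGEN unipotent `klingenUnipA Ψ` (★ F4-1; files F4, F4-3, F5) can regroup its `ξ`-cell:
* §1 bookkeeping: `apply_out_mul_coe_mul` (representative independence along the orbit, ★ O41.4 (b) `apply_out_mk_mul`), `mk_mul_coe_eq_mk_iff_isSiegelDelta`
  (stabiliser law), `exists_stabilizer_subgroupOf` (the stabiliser as a subgroup of `↥Nsub` with its membership law), `apply_coe_mul_of_mem` (left-`Γ'`-invariance of
  `u ↦ f(γ₀ u h)` when `γ₀ Γ' γ₀⁻¹ ⊆ P_Δ`, ★ #10b `apply_siegelDeltaRat_mul`);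
* §2 **`lintegral_enorm_section_unfold`** (Tonelli twin, NO hypothesis): `∫⁻ ‖f(γ₀ u h)‖ₑ β'(u) dνN = ∫⁻ (Σ'_i ‖f(γ₀ ν_i u h)‖ₑ) β(u) dνN`;
* §3 **`tsum_section_eq_integral_wt_smul_subgroup`** (E2, REGROUPING): `Γ' ≤ N(L⁺)` with `γ₀ Γ' γ₀⁻¹ ⊆ P_Δ` (any subgroup of the stabiliser), `β'` a `Γ'`-covering
  weight, `ν : ι → N(L⁺)` a section of `Γ'\N(L⁺)` (`∀ γ, ∃! i, γ ν_i⁻¹ ∈ Γ'`), and the orbit piece of (H) `∫⁻ (Σ'_i ‖f(γ₀ ν_i u h)‖ₑ) β dνN ≠ ∞`: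
  `Σ'_i ∫ β(u) • f(γ₀ ν_i u h) dνN(u) = ∫ β'(u) • f(γ₀ u h) dνN(u)`, and the right side is an absolutely convergent Bochner integral (`integrable_wt_smul_apply_coe_mul`).
[MoeglinWaldspurger1995, II.1.7], [KudlaRallis1994, §2 (2.10)–(2.12)], [GelbartPiatetskishapiroRallis1987, Part A §2], [Garrett2018, §3.10], [CogdellAnalyticTheory2004, §2.3].
HONEST LABEL.  Count-neutral helper: `HC_CM` is proved only modulo the 7 printed citations (2 remaining named inputs: hLiu418 = `stmt-HodgeConjecture-24832`,
h413 = `stmt-HodgeConjecture-24833`) until rung 0 closes.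
-/

set_option autoImplicit false
set_option linter.dupNamespace false -- the mandated namespace repeats `HodgeConjecture.HodgeConjecture`

noncomputable section

open scoped Matrix ENNReal NNReal
open NumberField IsDedekindDomain MeasureTheory MeasureTheory.Measure Filter Set Function
open Literature.NumberTheory.Automorphic Literature.NumberTheory.GaloisRepresentations
open Literature.NumberTheory.GelbartRogawski1991 Literature.NumberTheory.GelbartRogawski1991.GRConstruction
open Literature.NumberTheory.K2Lit.SiegelDoubled Literature.MeasureTheory.Group

namespace Summit.HodgeConjecture.HodgeConjecture.Cruxes.HLiu418.K2LiuSiegelQuotSubgroupOrbitUnfold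

open K2LiuSiegelDoubledUnfold K2LiuSiegelEisensteinDoubledLeftInvariant K2LiuConstantTermBigCellUnfold K2LiuSiegelBruhatMiddleCellDelta
  K2LiuSiegelEisensteinSubgroupPeriodCells

variable {L : Type} [Field L] [NumberField L] [IsCMField L]
variable {N M n : ℕ} {e : Fin N × Fin M ≃ Fin n}
  {dV : Fin N → L} {hdV : ∀ i, IsCMField.complexConj L (dV i) = dV i}
  {dW : Fin M → L} {hdW : ∀ i, IsCMField.complexConj L (dW i) = dW i}
variable {Nsub : Subgroup (HA L e dV hdV dW hdW)}

/-! ## §1 Bookkeeping along one `N(L⁺)`-orbit of `P_Δ(L⁺)\H(L⁺)` -/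

/-- **Representative independence along the orbit**: `f(γ_{⟦γ₀ ν⟧} x) = f(γ₀ ν x)` for a Siegel section `f`, `γ₀ ∈ H(L⁺)` and `ν ∈ N(L⁺) = Nsub ∩ H(L⁺)`
(★ O41.4 (b) `apply_out_mk_mul`). [cite: MoeglinWaldspurger1995, II.1.7] [cite: Garrett2018, §3.10] -/
theorem apply_out_mul_coe_mul {χ : HeckeCharacter L} {s : ℂ} {f : HA L e dV hdV dW hdW → ℂ} (hf : IsSiegelDeltaSection L e dV hdV dW hdW χ s f)
    (γ₀ : ratH L e dV hdV dW hdW) (ν : (ratH L e dV hdV dW hdW).subgroupOf Nsub) (x : HA L e dV hdV dW hdW) :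
    f ((((Quotient.out (Quotient.mk (MulAction.orbitRel (siegelDeltaRat L e dV hdV dW hdW) (ratH L e dV hdV dW hdW))
        (γ₀ * ⟨((ν : Nsub) : HA L e dV hdV dW hdW), coe_coe_mem_ratH ν⟩) :
          SiegelDeltaQuot L e dV hdV dW hdW) : ratH L e dV hdV dW hdW) : HA L e dV hdV dW hdW)) * x) =
      f ((γ₀ : HA L e dV hdV dW hdW) * ((ν : Nsub) : HA L e dV hdV dW hdW) * x) :=
  apply_out_mk_mul hf _ x

/-- **Stabiliser law**: for `ν ∈ N(L⁺)`, `⟦γ₀ ν⟧ = ⟦γ₀⟧ ⟺ γ₀ ν γ₀⁻¹ ∈ P_Δ` (★ B2b `mk_mul_eq_mk_iff`). [cite: MoeglinWaldspurger1995, II.1.7] -/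
theorem mk_mul_coe_eq_mk_iff_isSiegelDelta (γ₀ : ratH L e dV hdV dW hdW) (ν : (ratH L e dV hdV dW hdW).subgroupOf Nsub) :
    (Quotient.mk (MulAction.orbitRel (siegelDeltaRat L e dV hdV dW hdW) (ratH L e dV hdV dW hdW))
        (γ₀ * ⟨((ν : Nsub) : HA L e dV hdV dW hdW), coe_coe_mem_ratH ν⟩) : SiegelDeltaQuot L e dV hdV dW hdW) =
        Quotient.mk (MulAction.orbitRel (siegelDeltaRat L e dV hdV dW hdW) (ratH L e dV hdV dW hdW)) γ₀ ↔
      IsSiegelDelta L e dV hdV dW hdW ((γ₀ : HA L e dV hdV dW hdW) * ((ν : Nsub) : HA L e dV hdV dW hdW) * ((γ₀ : HA L e dV hdV dW hdW))⁻¹) :=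
  mk_mul_eq_mk_iff γ₀ _

/-- **orbit law**: for `a, b ∈ N(L⁺)`, `⟦γ₀ a⟧ = ⟦γ₀ b⟧ ⟺ γ₀ (a b⁻¹) γ₀⁻¹ ∈ P_Δ` — the orbit of `⟦γ₀⟧` is `Stab(γ₀)\N(L⁺)`. [cite: MoeglinWaldspurger1995, II.1.7] -/
theorem mk_mul_coe_eq_mk_mul_coe_iff (γ₀ : ratH L e dV hdV dW hdW) (a b : (ratH L e dV hdV dW hdW).subgroupOf Nsub) :
    (Quotient.mk (MulAction.orbitRel (siegelDeltaRat L e dV hdV dW hdW) (ratH L e dV hdV dW hdW))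
        (γ₀ * ⟨((a : Nsub) : HA L e dV hdV dW hdW), coe_coe_mem_ratH a⟩) : SiegelDeltaQuot L e dV hdV dW hdW) =
        Quotient.mk (MulAction.orbitRel (siegelDeltaRat L e dV hdV dW hdW) (ratH L e dV hdV dW hdW))
          (γ₀ * ⟨((b : Nsub) : HA L e dV hdV dW hdW), coe_coe_mem_ratH b⟩) ↔
      IsSiegelDelta L e dV hdV dW hdW ((γ₀ : HA L e dV hdV dW hdW) * (((a * b⁻¹ : (ratH L e dV hdV dW hdW).subgroupOf Nsub) : Nsub) : HA L e dV hdV dW hdW) *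
        ((γ₀ : HA L e dV hdV dW hdW))⁻¹) := by
  rw [mk_eq_mk_iff_isSiegelDelta]
  have h : ((γ₀ * ⟨((b : Nsub) : HA L e dV hdV dW hdW), coe_coe_mem_ratH b⟩ : ratH L e dV hdV dW hdW) : HA L e dV hdV dW hdW) *
      (((γ₀ * ⟨((a : Nsub) : HA L e dV hdV dW hdW), coe_coe_mem_ratH a⟩ : ratH L e dV hdV dW hdW) : HA L e dV hdV dW hdW))⁻¹ =
      ((γ₀ : HA L e dV hdV dW hdW) * (((a * b⁻¹ : (ratH L e dV hdV dW hdW).subgroupOf Nsub) : Nsub) : HA L e dV hdV dW hdW) *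
        ((γ₀ : HA L e dV hdV dW hdW))⁻¹)⁻¹ := by
    simp only [Subgroup.coe_mul, InvMemClass.coe_inv, mul_inv_rev, inv_inv, mul_assoc]
  rw [h]
  exact ⟨fun hP => by simpa using isSiegelDelta_inv L e dV hdV dW hdW hP, fun hP => isSiegelDelta_inv L e dV hdV dW hdW hP⟩

variable (Nsub) in
/-- **the stabiliser `Stab(γ₀) = {u ∈ N(L⁺) : γ₀ u γ₀⁻¹ ∈ P_Δ}` as a subgroup of `↥Nsub`** (existence with its membership law; `Stab(γ₀) ≤ N(L⁺)`).
[cite: MoeglinWaldspurger1995, II.1.7] -/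
theorem exists_stabilizer_subgroupOf (γ₀ : ratH L e dV hdV dW hdW) :
    ∃ Γ' : Subgroup Nsub, Γ' ≤ (ratH L e dV hdV dW hdW).subgroupOf Nsub ∧ ∀ u : Nsub,
      u ∈ Γ' ↔ (u : HA L e dV hdV dW hdW) ∈ ratH L e dV hdV dW hdW ∧
        IsSiegelDelta L e dV hdV dW hdW ((γ₀ : HA L e dV hdV dW hdW) * (u : HA L e dV hdV dW hdW) * ((γ₀ : HA L e dV hdV dW hdW))⁻¹) := by
  have hconj : ∀ x y : HA L e dV hdV dW hdW, (γ₀ : HA L e dV hdV dW hdW) * (x * y) * ((γ₀ : HA L e dV hdV dW hdW))⁻¹ =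
      ((γ₀ : HA L e dV hdV dW hdW) * x * ((γ₀ : HA L e dV hdV dW hdW))⁻¹) * ((γ₀ : HA L e dV hdV dW hdW) * y * ((γ₀ : HA L e dV hdV dW hdW))⁻¹) :=
    fun x y => by simp only [mul_assoc, inv_mul_cancel_left]
  have hinv : ∀ x : HA L e dV hdV dW hdW, (γ₀ : HA L e dV hdV dW hdW) * x⁻¹ * ((γ₀ : HA L e dV hdV dW hdW))⁻¹ =
      ((γ₀ : HA L e dV hdV dW hdW) * x * ((γ₀ : HA L e dV hdV dW hdW))⁻¹)⁻¹ := fun x => by simp only [mul_inv_rev, inv_inv, mul_assoc]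
  refine ⟨{ carrier := {u | (u : HA L e dV hdV dW hdW) ∈ ratH L e dV hdV dW hdW ∧
              IsSiegelDelta L e dV hdV dW hdW ((γ₀ : HA L e dV hdV dW hdW) * (u : HA L e dV hdV dW hdW) * ((γ₀ : HA L e dV hdV dW hdW))⁻¹)}
            one_mem' := ⟨one_mem _, by
              rw [OneMemClass.coe_one, mul_one, mul_inv_cancel]; exact isSiegelDelta_one' L e dV hdV dW hdW⟩
            mul_mem' := fun {a b} ha hb => ⟨mul_mem ha.1 hb.1, by
              have hab : (((a * b : Nsub)) : HA L e dV hdV dW hdW) = (a : HA L e dV hdV dW hdW) * (b : HA L e dV hdV dW hdW) := rfl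
              rw [hab, hconj]; exact isSiegelDelta_mul L e dV hdV dW hdW ha.2 hb.2⟩
            inv_mem' := fun {a} ha => ⟨inv_mem ha.1, by
              have hai : (((a⁻¹ : Nsub)) : HA L e dV hdV dW hdW) = ((a : HA L e dV hdV dW hdW))⁻¹ := rfl
              rw [hai, hinv]; exact isSiegelDelta_inv L e dV hdV dW hdW ha.2⟩ }, fun u hu => Subgroup.mem_subgroupOf.2 hu.1, fun u => Iff.rfl⟩

/-- **left-`Γ'`-invariance of the orbit integrand**: `f(γ₀ (γ u) h) = f(γ₀ u h)` for `γ ∈ Γ' ≤ N(L⁺)` with `γ₀ Γ' γ₀⁻¹ ⊆ P_Δ` (the conjugate is a RATIONAL Siegel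
element, on which a Siegel section is invariant: ★ #10b `apply_siegelDeltaRat_mul`). [cite: MoeglinWaldspurger1995, II.1.7] -/
theorem apply_coe_mul_of_mem {χ : HeckeCharacter L} {s : ℂ} {f : HA L e dV hdV dW hdW → ℂ} (hf : IsSiegelDeltaSection L e dV hdV dW hdW χ s f)
    (γ₀ : ratH L e dV hdV dW hdW) (h : HA L e dV hdV dW hdW) (Γ' : Subgroup Nsub)
    (hΓ'rat : ∀ γ ∈ Γ', ((γ : Nsub) : HA L e dV hdV dW hdW) ∈ ratH L e dV hdV dW hdW)
    (hΓ'P : ∀ γ ∈ Γ', IsSiegelDelta L e dV hdV dW hdW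
      ((γ₀ : HA L e dV hdV dW hdW) * ((γ : Nsub) : HA L e dV hdV dW hdW) * ((γ₀ : HA L e dV hdV dW hdW))⁻¹))
    {γ : Nsub} (hγ : γ ∈ Γ') (u : Nsub) :
    f ((γ₀ : HA L e dV hdV dW hdW) * (((γ * u : Nsub)) : HA L e dV hdV dW hdW) * h) = f ((γ₀ : HA L e dV hdV dW hdW) * (u : HA L e dV hdV dW hdW) * h) := by
  have hrat : (γ₀ : HA L e dV hdV dW hdW) * ((γ : Nsub) : HA L e dV hdV dW hdW) * ((γ₀ : HA L e dV hdV dW hdW))⁻¹ ∈ ratH L e dV hdV dW hdW :=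
    mul_mem (mul_mem γ₀.2 (hΓ'rat γ hγ)) (inv_mem γ₀.2)
  set p : siegelDeltaRat L e dV hdV dW hdW := ⟨⟨_, hrat⟩, Subgroup.mem_subgroupOf.2 ((mem_siegelDelta_iff L e dV hdV dW hdW _).2 (hΓ'P γ hγ))⟩ with hp
  have hconj : (γ₀ : HA L e dV hdV dW hdW) * (((γ * u : Nsub)) : HA L e dV hdV dW hdW) * h =
      ((γ₀ : HA L e dV hdV dW hdW) * ((γ : Nsub) : HA L e dV hdV dW hdW) * ((γ₀ : HA L e dV hdV dW hdW))⁻¹) *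
        ((γ₀ : HA L e dV hdV dW hdW) * (u : HA L e dV hdV dW hdW) * h) := by
    rw [Subgroup.coe_mul]; simp only [mul_assoc, inv_mul_cancel_left]
  rw [hconj]
  exact apply_siegelDeltaRat_mul L e dV hdV dW hdW hf p _

/-! ## §2 The Tonelli twin: unfolding the `L¹`-size along a section (no hypothesis) -/

section Orbit

variable [MeasurableSpace Nsub] [BorelSpace Nsub]

/-- **UNFOLDING THE `L¹` SIZE ALONG A SECTION** (Tonelli, an identity in `[0,∞]`, no convergence hypothesis): with `νN` left-invariant, `β` an `N(L⁺)`-weight,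
`Γ' ≤ N(L⁺)` with `γ₀ Γ' γ₀⁻¹ ⊆ P_Δ`, `β'` a `Γ'`-weight and `ν` a section of `Γ'\N(L⁺)`:
  `∫⁻ ‖f(γ₀ u h)‖ₑ β'(u) dνN = ∫⁻ (Σ'_i ‖f(γ₀ ν_i u h)‖ₑ) β(u) dνN`
(★ `lintegral_mul_eq_lintegral_tsum_mul`). [cite: MoeglinWaldspurger1995, II.1.7] [cite: CogdellAnalyticTheory2004, §2.3] -/
theorem lintegral_enorm_section_unfold (νN : Measure Nsub) [νN.IsMulLeftInvariant]
    {β : Nsub → ℝ≥0∞} (hβ : IsCoveringWeight ((ratH L e dV hdV dW hdW).subgroupOf Nsub) β)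
    {χ : HeckeCharacter L} {s : ℂ} {f : HA L e dV hdV dW hdW → ℂ} (hf : IsSiegelDeltaSection L e dV hdV dW hdW χ s f) (hfc : Continuous f)
    (γ₀ : ratH L e dV hdV dW hdW) (h : HA L e dV hdV dW hdW)
    (Γ' : Subgroup Nsub) (hΓ'le : Γ' ≤ (ratH L e dV hdV dW hdW).subgroupOf Nsub)
    (hΓ'P : ∀ γ ∈ Γ', IsSiegelDelta L e dV hdV dW hdW
      ((γ₀ : HA L e dV hdV dW hdW) * ((γ : Nsub) : HA L e dV hdV dW hdW) * ((γ₀ : HA L e dV hdV dW hdW))⁻¹))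
    {β' : Nsub → ℝ≥0∞} (hβ' : IsCoveringWeight Γ' β')
    {ι : Type*} [Countable ι] (ν : ι → (ratH L e dV hdV dW hdW).subgroupOf Nsub)
    (hν : ∀ γ ∈ (ratH L e dV hdV dW hdW).subgroupOf Nsub, ∃! i, γ * ((ν i : Nsub))⁻¹ ∈ Γ') :
    ∫⁻ u, ‖f ((γ₀ : HA L e dV hdV dW hdW) * (u : HA L e dV hdV dW hdW) * h)‖ₑ * β' u ∂νN =
      ∫⁻ u, (∑' i, ‖f ((γ₀ : HA L e dV hdV dW hdW) * (((ν i : Nsub)) : HA L e dV hdV dW hdW) * ((u : HA L e dV hdV dW hdW) * h))‖ₑ) * β u ∂νN := by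
  haveI : Countable ((ratH L e dV hdV dW hdW).subgroupOf Nsub) := countable_subgroupOf_ratH Nsub
  haveI : MeasurableConstSMul Nsub Nsub := ⟨fun g => measurable_const_mul g⟩
  haveI : SMulInvariantMeasure Nsub Nsub νN :=
    ⟨fun g t _ht => by rw [show (fun x : Nsub => g • x) ⁻¹' t = (fun x => g * x) ⁻¹' t from rfl, measure_preimage_mul]⟩
  have hΓ'rat : ∀ γ ∈ Γ', ((γ : Nsub) : HA L e dV hdV dW hdW) ∈ ratH L e dV hdV dW hdW := fun γ hγ => coe_mem_ratH_of_mem_subgroupOf (hΓ'le hγ)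
  have hFn : Measurable fun u : Nsub => ‖f ((γ₀ : HA L e dV hdV dW hdW) * (u : HA L e dV hdV dW hdW) * h)‖ₑ :=
    measurable_enorm_apply_mul_coe_mul_subgroup hfc _ h
  have hFninv : ∀ γ ∈ Γ', ∀ u : Nsub,
      ‖f ((γ₀ : HA L e dV hdV dW hdW) * (((γ • u : Nsub)) : HA L e dV hdV dW hdW) * h)‖ₑ = ‖f ((γ₀ : HA L e dV hdV dW hdW) * (u : HA L e dV hdV dW hdW) * h)‖ₑ :=
    fun γ hγ u => by rw [smul_eq_mul, apply_coe_mul_of_mem hf γ₀ h Γ' hΓ'rat hΓ'P hγ u]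
  rw [lintegral_mul_eq_lintegral_tsum_mul νN ((ratH L e dV hdV dW hdW).subgroupOf Nsub) Γ' hΓ'le hFn hFninv hβ'.1 hβ'.2 hβ.1 hβ.2
    (s := fun i => (ν i : Nsub)) (fun i => (ν i).2) hν]
  refine lintegral_congr fun u => ?_
  congr 1
  refine tsum_congr fun i => ?_
  rw [smul_eq_mul, Subgroup.coe_mul, ← mul_assoc, ← mul_assoc]

/-- **the orbit integral is absolutely convergent under the orbit piece of (H)**: `u ↦ β'(u) • f(γ₀ u h)` is `νN`-integrable. [cite: MoeglinWaldspurger1995, II.1.7] -/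
theorem integrable_wt_smul_apply_coe_mul (νN : Measure Nsub) [νN.IsMulLeftInvariant]
    {β : Nsub → ℝ≥0∞} (hβ : IsCoveringWeight ((ratH L e dV hdV dW hdW).subgroupOf Nsub) β)
    {χ : HeckeCharacter L} {s : ℂ} {f : HA L e dV hdV dW hdW → ℂ} (hf : IsSiegelDeltaSection L e dV hdV dW hdW χ s f) (hfc : Continuous f)
    (γ₀ : ratH L e dV hdV dW hdW) (h : HA L e dV hdV dW hdW)
    (Γ' : Subgroup Nsub) (hΓ'le : Γ' ≤ (ratH L e dV hdV dW hdW).subgroupOf Nsub)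
    (hΓ'P : ∀ γ ∈ Γ', IsSiegelDelta L e dV hdV dW hdW
      ((γ₀ : HA L e dV hdV dW hdW) * ((γ : Nsub) : HA L e dV hdV dW hdW) * ((γ₀ : HA L e dV hdV dW hdW))⁻¹))
    {β' : Nsub → ℝ≥0∞} (hβ' : IsCoveringWeight Γ' β')
    {ι : Type*} [Countable ι] (ν : ι → (ratH L e dV hdV dW hdW).subgroupOf Nsub)
    (hν : ∀ γ ∈ (ratH L e dV hdV dW hdW).subgroupOf Nsub, ∃! i, γ * ((ν i : Nsub))⁻¹ ∈ Γ')
    (hO : ∫⁻ u, (∑' i, ‖f ((γ₀ : HA L e dV hdV dW hdW) * (((ν i : Nsub)) : HA L e dV hdV dW hdW) *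
      ((u : HA L e dV hdV dW hdW) * h))‖ₑ) * β u ∂νN ≠ ∞) :
    Integrable (fun u : Nsub => (β' u).toReal • f ((γ₀ : HA L e dV hdV dW hdW) * (u : HA L e dV hdV dW hdW) * h)) νN := by
  refine ⟨(hβ'.1.ennreal_toReal.smul (hfc.comp ((continuous_const.mul continuous_subtype_val).mul continuous_const)).measurable).aestronglyMeasurable, ?_⟩
  rw [hasFiniteIntegral_iff_enorm]
  simp_rw [enorm_wt_smul_subgroup hβ']
  rw [lintegral_enorm_section_unfold νN hβ hf hfc γ₀ h Γ' hΓ'le hΓ'P hβ' ν hν]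
  exact lt_top_iff_ne_top.2 hO

/-! ## §3 Regrouping along one orbit, over a section of `Γ'\N(L⁺)` -/

set_option maxHeartbeats 400000 in
-- one long linear unfolding (Tonelli transport of the `L¹` bound, Bochner unfolding over the section, Fubini for series), as ★ Φ2-3
/-- **REGROUPING ALONG ONE `N(L⁺)`-ORBIT, OVER A SECTION (E2), for an arbitrary subgroup `Nsub ≤ H(𝔸)`.**  `νN` left-invariant on `↥Nsub`; `β` an `N(L⁺)`-covering weight
(`N(L⁺) = Nsub ∩ H(L⁺)`); `f` a continuous Siegel section of `I_Δ(s, χ)`; `γ₀ ∈ H(L⁺)`; `Γ' ≤ N(L⁺)` with `γ₀ Γ' γ₀⁻¹ ⊆ P_Δ` and `β'` a `Γ'`-covering weight; `ν : ι → N(L⁺)` a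
SECTION of `Γ'\N(L⁺)` (`∀ γ, ∃! i, γ ν_i⁻¹ ∈ Γ'`); and the orbit piece of (H): `∫⁻ (Σ'_i ‖f(γ₀ ν_i u h)‖ₑ) β dνN ≠ ∞`.  THEN
  `Σ'_i ∫ β(u) • f(γ₀ ν_i u h) dνN(u) = ∫ β'(u) • f(γ₀ u h) dνN(u)`.
With `Γ' = Stab(γ₀)` (`exists_stabilizer_subgroupOf`) the left side is the sum of `∫ β • f(γ_q u h)` over the orbit `{⟦γ₀ ν⟧}` (`apply_out_mul_coe_mul`); for
`Nsub := klingenUnipA Ψ`, `γ₀ = Ψ(ξ m)` it is one orbit of the `ξ`-cell of the Q-constant term (files F4, F4-3). [cite: MoeglinWaldspurger1995, II.1.7] [cite: KudlaRallis1994, §2]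
[cite: Garrett2018, §3.10] [cite: CogdellAnalyticTheory2004, §2.3] -/
theorem tsum_section_eq_integral_wt_smul_subgroup (νN : Measure Nsub) [νN.IsMulLeftInvariant]
    {β : Nsub → ℝ≥0∞} (hβ : IsCoveringWeight ((ratH L e dV hdV dW hdW).subgroupOf Nsub) β)
    {χ : HeckeCharacter L} {s : ℂ} {f : HA L e dV hdV dW hdW → ℂ} (hf : IsSiegelDeltaSection L e dV hdV dW hdW χ s f) (hfc : Continuous f)
    (γ₀ : ratH L e dV hdV dW hdW) (h : HA L e dV hdV dW hdW)
    (Γ' : Subgroup Nsub) (hΓ'le : Γ' ≤ (ratH L e dV hdV dW hdW).subgroupOf Nsub)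
    (hΓ'P : ∀ γ ∈ Γ', IsSiegelDelta L e dV hdV dW hdW
      ((γ₀ : HA L e dV hdV dW hdW) * ((γ : Nsub) : HA L e dV hdV dW hdW) * ((γ₀ : HA L e dV hdV dW hdW))⁻¹))
    {β' : Nsub → ℝ≥0∞} (hβ' : IsCoveringWeight Γ' β')
    {ι : Type*} [Countable ι] (ν : ι → (ratH L e dV hdV dW hdW).subgroupOf Nsub)
    (hν : ∀ γ ∈ (ratH L e dV hdV dW hdW).subgroupOf Nsub, ∃! i, γ * ((ν i : Nsub))⁻¹ ∈ Γ')
    (hO : ∫⁻ u, (∑' i, ‖f ((γ₀ : HA L e dV hdV dW hdW) * (((ν i : Nsub)) : HA L e dV hdV dW hdW) *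
      ((u : HA L e dV hdV dW hdW) * h))‖ₑ) * β u ∂νN ≠ ∞) :
    ∑' i, ∫ u, (β u).toReal • f ((γ₀ : HA L e dV hdV dW hdW) * (((ν i : Nsub)) : HA L e dV hdV dW hdW) * ((u : HA L e dV hdV dW hdW) * h)) ∂νN =
      ∫ u, (β' u).toReal • f ((γ₀ : HA L e dV hdV dW hdW) * (u : HA L e dV hdV dW hdW) * h) ∂νN := by
  haveI : Countable ((ratH L e dV hdV dW hdW).subgroupOf Nsub) := countable_subgroupOf_ratH Nsub
  haveI : MeasurableConstSMul Nsub Nsub := ⟨fun g => measurable_const_mul g⟩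
  haveI : SMulInvariantMeasure Nsub Nsub νN :=
    ⟨fun g t _ht => by rw [show (fun x : Nsub => g • x) ⁻¹' t = (fun x => g * x) ⁻¹' t from rfl, measure_preimage_mul]⟩
  have hΓ'rat : ∀ γ ∈ Γ', ((γ : Nsub) : HA L e dV hdV dW hdW) ∈ ratH L e dV hdV dW hdW := fun γ hγ => coe_mem_ratH_of_mem_subgroupOf (hΓ'le hγ)
  -- the integrand `F(u) = f(γ₀ u h)`, its `Γ'`-invariance, and its values along the section
  set F : Nsub → ℂ := fun u => f ((γ₀ : HA L e dV hdV dW hdW) * (u : HA L e dV hdV dW hdW) * h) with hFdef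
  have hFm : StronglyMeasurable F := (hfc.comp ((continuous_const.mul continuous_subtype_val).mul continuous_const)).stronglyMeasurable
  have hFinv : ∀ γ ∈ Γ', ∀ u : Nsub, F (γ • u) = F u := fun γ hγ u => by
    rw [hFdef]
    dsimp only
    rw [smul_eq_mul, apply_coe_mul_of_mem hf γ₀ h Γ' hΓ'rat hΓ'P hγ u]
  have hFs : ∀ (i : ι) (u : Nsub), F (((ν i : Nsub)) • u) =
      f ((γ₀ : HA L e dV hdV dW hdW) * (((ν i : Nsub)) : HA L e dV hdV dW hdW) * ((u : HA L e dV hdV dW hdW) * h)) := fun i u => by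
    rw [hFdef]
    dsimp only
    rw [smul_eq_mul, Subgroup.coe_mul, ← mul_assoc, ← mul_assoc]
  -- the `L¹` bound for `F` against `β'`, transported from the orbit piece of (H) by Tonelli unfolding (§2)
  have hint : ∫⁻ u, ‖F u‖ₑ * β' u ∂νN < ∞ := by
    rw [hFdef]
    dsimp only
    rw [lintegral_enorm_section_unfold νN hβ hf hfc γ₀ h Γ' hΓ'le hΓ'P hβ' ν hν]
    exact lt_top_iff_ne_top.2 hO
  -- Bochner unfolding
  have key := integral_wt_smul_eq_integral_wt_smul_tsum νN ((ratH L e dV hdV dW hdW).subgroupOf Nsub) Γ' hΓ'le hFm hFinv hβ'.1 hβ'.2 hβ.1 hβ.2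
    (s := fun i => (ν i : Nsub)) (fun i => (ν i).2) hν hint
  rw [show (∫ u, (β' u).toReal • f ((γ₀ : HA L e dV hdV dW hdW) * (u : HA L e dV hdV dW hdW) * h) ∂νN) = ∫ u, wt β' u • F u ∂νN from rfl, key]
  simp_rw [hFs]
  -- Fubini for series: `∫ β • Σ'_i G_i = Σ'_i ∫ β • G_i`
  set Fq : ι → Nsub → ℂ := fun i u =>
    f ((γ₀ : HA L e dV hdV dW hdW) * (((ν i : Nsub)) : HA L e dV hdV dW hdW) * ((u : HA L e dV hdV dW hdW) * h)) with hFq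
  set g : ι → Nsub → ℂ := fun i u => (β u).toReal • Fq i u with hg
  have hgm : ∀ i, AEStronglyMeasurable (g i) νN := fun i => aestronglyMeasurable_wt_smul_apply_subgroup νN hβ.1 hfc _ h
  have hgn : ∀ i u, ‖g i u‖ₑ = ‖Fq i u‖ₑ * β u := fun i u => enorm_wt_smul_subgroup hβ u _
  have hFqm : ∀ i, Measurable fun u => ‖Fq i u‖ₑ := fun i => measurable_enorm_apply_mul_coe_mul_subgroup' hfc _ h
  have hsum : ∑' i, ∫⁻ u, ‖g i u‖ₑ ∂νN ≠ ∞ := by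
    simp_rw [hgn]
    rw [← lintegral_tsum (f := fun i u => ‖Fq i u‖ₑ * β u) fun i => ((hFqm i).mul hβ.1).aemeasurable]
    simp_rw [ENNReal.tsum_mul_right]
    exact hO
  rw [show (∑' i, ∫ u, (β u).toReal • Fq i u ∂νN) = ∑' i, ∫ u, g i u ∂νN from rfl, ← integral_tsum hgm hsum]
  refine integral_congr_ae (ae_of_all _ fun u => ?_)
  show (∑' i, (β u).toReal • Fq i u) = wt β u • _
  rw [tsum_const_smul'' (β u).toReal]

end Orbit

end Summit.HodgeConjecture.HodgeConjecture.Cruxes.HLiu418.K2LiuSiegelQuotSubgroupOrbitUnfold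

end
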